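import Mathlib.Topology.Homotopy.Equiv
import Mathlib.Geometry.Manifold.Instances.Real
import HarnessLib

/-!
# Named fact: a topological 4-manifold homotopy equivalent to `S⁴` is compact

Grounder file (D-0014 named facts) for the `SmoothPoincare4` routes (reduction items
stmt-SmoothPoincare4-0441/0449, definition-demand wi-03934): the packaging step from Mathlib's
`SmoothPoincareConjectureFour`-style hypotheses (`M ≃ₕ S⁴`, a HOMOTOPY equivalence) to the
compact `Literature.HomotopySphere 4` needs compactness of `M`, which is a genuine (homological)
fact: a connected non-compact topological `n`-manifold has `H_n(M; ℤ) = 0` (Hatcher,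
*Algebraic Topology*, Prop. 3.29), whereas `H₄(M; ℤ) ≅ H₄(S⁴; ℤ) ≅ ℤ` by homotopy invariance
(Cor. 2.11) and `H₄(S⁴) ≅ ℤ`; connectedness of `M` also follows from `M ≃ₕ S⁴` (`π₀`).

Nothing is asserted; users take `(h : Literature.compactSpace_of_homotopyEquiv_sphere_four)`.

## References

* A. Hatcher, *Algebraic Topology*, CUP 2002, Prop. 3.29, Cor. 2.11, Thm. 2.13.
-/

noncomputable section

open scoped Manifold ContDiff
open ContinuousMap

universe u

namespace Literature.Topology.FourManifolds

/-- NAMED FACT (Hatcher 2002, Prop. 3.29 with Cor. 2.11: a non-compact connected `n`-manifold has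
vanishing `H_n(·; ℤ)`, and singular homology is a homotopy invariant). Every Hausdorff,
second-countable topological space carrying a `C^∞` manifold structure modelled on `ℝ⁴` that is
homotopy equivalent to the standard `S⁴` is compact. Users take
`(h : compactSpace_of_homotopyEquiv_sphere_four)`.
[cite: HatcherAT2002, Prop. 3.29 and Cor. 2.11] -/
def compactSpace_of_homotopyEquiv_sphere_four : Prop :=
  ∀ (M : Type u) [TopologicalSpace M] [T2Space M] [SecondCountableTopology M]
    [ChartedSpace (EuclideanSpace ℝ (Fin 4)) M] [IsManifold (𝓡 4) ∞ M],
    M ≃ₕ Metric.sphere (0 : EuclideanSpace ℝ (Fin 5)) 1 → CompactSpace M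

end Literature.Topology.FourManifolds

end
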